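import Summits.QuantumFields.YangMills.Theorems.BalabanUVNodesN19LawPriceSymmetric
import Summits.QuantumFields.YangMills.Theorems.BalabanUVNodesN19ContinuumLawAtScheme

/-!
# YM-DAG node N19 (= NE7 proper) — THE LAW-LEVEL PRICE AT THE SCHEME: under `Target`, the laws of the string observable converge to the
# continuum law IN THE BOUNDED-LIPSCHITZ METRIC with an explicit modulus in the tail `τ_K = ∑_m 2vol·δ_{K+m}`

Cell `pub-ymgap`, HUMAN RULING D-0062 (Track A), R141 (C) wider-strategy seat `pub-ymgap-dag-n19-e` (strategy s3 = ALTERNATIVE CURRENCY), generation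
g17, module 7 (the by-name face AT THE SCHEME of modules 4–6).  Route `Summits/QuantumFields/YangMills/Theses/BalabanUVNodes.lean` rev 25, cluster item
K3⁷ «SpineGivenEndpointR13SepCoPH» (stmt-QuantumFields-20544, dag-lead WORDS-143); filed `--supports` that item `--as helper` (it proves no registered stub).
COUNT-NEUTRAL: bookkeeping over the tree's `T4GenFunBounds` (`genFun_schemeZ_eq_cgf`, `measurable_prodObs`, `abs_prodObs_le_one`,
`isProbabilityMeasure_gibbsMeasure`), `T4CauchySum.abs_genFun_sub_lim_le`, the seat's p505344 `…N19ContinuumLawAtScheme` (`genFunLim_eq_cgf_of_continuumLaw`,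
`continuumLaw_of_target`) and the sibling `…N19LawPriceSymmetric` BY NAME; `Spine.NE7.Target` is a HYPOTHESIS (N19's DECL-target shape, NOT PRINTED, NOT
proved); NOT a discharge claim.

THE RESULT.  g9 (p504707 ∕ p505344) typed the CONTINUUM LAW of one string observable under `Target`: the laws of `∏os` under `gibbs_K` converge WEAKLY to a
unique probability law `ν` on `[−1,1]` — qualitatively.  Modules 4–6 price the law in the window data.  Here the two meet: the law of `∏os` under `gibbs_K`
(pushed to `ℝ`: a law on `[−1,1]` whose cgf IS `genFun (schemeZ S os) K`) and `ν` (whose cgf is `genFunLim`, p505344) have cgf's `τ_K`-close on `|t| ≤ l₀`,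
`τ_K = ∑_m 2vol·δ_{K+m}` (the tree's tail bound), so ★★ `abs_integral_prodObs_sub_continuumLaw_le`:
`|∫ g(∏os) dgibbs_K − ∫ g dν| ≤ 2Kg∕√n + Gb·(3A_K)ⁿ·n!·2τ_K e^{2l₀}` for every `Kg`-Lipschitz `g` with `|g| ≤ Gb` on `[−1,1]`, every `n ≥ 1`, every `K`
(`A_K = max(1, e·max(1, log⁺τ_K⁻¹)∕l₀)`); ★★ `boundedLipschitz_convergence_of_target`: ∀ `η > 0` ∃ `K₀` ∀ `K ≥ K₀` ∀ `1`-Lipschitz `g` with `|g| ≤ 1` on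
`[−1,1]`: `|∫ g(∏os) dgibbs_K − ∫ g dν| ≤ η` — WEAK convergence upgraded to convergence in the BOUNDED-LIPSCHITZ metric (uniform over the test class), from
N19's currency alone; ★ `exists_continuumLaw_boundedLipschitz_of_target` assembles with p505344's existence.  With geometric remainders (`τ_K ≍ θ^K`,
`L_K ≍ K`) the modulus is of order `√(log K ∕ K)`-type per unit Lipschitz constant (modules 4–5; not optimised — Jackson would give `log K∕K`), and by
`…N19LawPrice` no modulus better than `log L∕L` in `τ` is available from window matching.

HONEST FRAMING (binding).  Bookkeeping; `Target` ∕ the continuum law are HYPOTHESES ∕ derived objects of a conditional statement; NO consumer in the DAG today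
beyond g9's law (the apex consumes expectations); nothing of Bałaban's is instantiated; NE7 ∕ NE7b ∕ NE7c NOT PRINTED, NOT proved; N19 NOT discharged;
count-neutral.  One finite `T⁴` programme at fixed `ε`; nothing continuum ∕ `ℝ⁴` ∕ OS ∕ mass-gap ∕ Clay.  0 `def` ∕ 0 `sorry`.
-/

noncomputable section

open Set Filter Topology Real MeasureTheory ProbabilityTheory

namespace Summit.QuantumFields.YangMills.Theorems.BalabanUVNodesN19LawPriceAtScheme

open Literature.MathematicalPhysics.QuantumFieldTheory.Balaban1983to89
open T4CauchySum (MatchingModConstants genFun genFunLim abs_genFun_sub_lim_le)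
open T4GenFunBounds (schemeZ prodObs gibbsMeasure)
open Missing (TorusScheme)
open Summit.QuantumFields.BalabanUV.T4Continuum.Spine
open Summit.QuantumFields.YangMills.BalabanUVNodes.N19ExpectationCurrencyAtScheme (mul_nonneg_of_matchingModConstants)
open Summit.QuantumFields.YangMills.BalabanUVNodes.N19ContinuumLawAtScheme (genFunLim_eq_cgf_of_continuumLaw continuumLaw_of_target)
open Summit.QuantumFields.YangMills.Theorems.BalabanUVNodesN19LawPriceSymmetric
  (abs_integral_sub_integral_le_lipschitz_of_cgf_close_symm law_controlled_of_cgf_close_symm)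

section Scheme

variable {G : Type*} [GaugeGroup G] [MeasurableSpace G] [RegularGaugeGroup G] [HaarData G] {O : Type*}
  (S : TorusScheme G O) (hβ : ∀ K, 0 ≤ S.β K) (hm : ∀ K o, Measurable (S.obs K o))
  (h1 : ∀ K o U, |S.obs K o U| ≤ 1)
include hβ hm h1

omit [RegularGaugeGroup G] hβ in
/-- The law of the string observable `∏os` under `gibbs_K`, pushed to `ℝ`, lives on `[−1, 1]`. [bookkeeping] -/
theorem map_prodObs_Icc_compl (K : ℕ) (os : List O) :
    ((gibbsMeasure (S.P K) (S.β K)).map (prodObs S K os)) (Icc (-1) 1)ᶜ = 0 := by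
  rw [Measure.map_apply (T4GenFunBounds.measurable_prodObs S hm K os) measurableSet_Icc.compl]
  have : prodObs S K os ⁻¹' (Icc (-1 : ℝ) 1)ᶜ = ∅ := by
    ext U
    simp only [mem_preimage, mem_compl_iff, mem_Icc, mem_empty_iff_false, iff_false, not_not]
    exact abs_le.1 (T4GenFunBounds.abs_prodObs_le_one S h1 K os U)
  rw [this, measure_empty]

/-- Its cgf is the scheme's generating function: `cgf id (gibbs_K ∘ (∏os)⁻¹) t = genFun (schemeZ S os) K t`. [bookkeeping] -/
theorem cgf_map_prodObs (K : ℕ) (os : List O) (t : ℝ) :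
    cgf id ((gibbsMeasure (S.P K) (S.β K)).map (prodObs S K os)) t = genFun (schemeZ S os) K t := by
  rw [T4GenFunBounds.genFun_schemeZ_eq_cgf S hβ hm h1, cgf, cgf, mgf_id_map (T4GenFunBounds.measurable_prodObs S hm K os).aemeasurable]

/-- **★★ THE LAW-LEVEL PRICE AT THE SCHEME (explicit, every degree `n`).**  Under N19's DECL target `Spine.NE7.Target vol l₀ δ (schemeZ S os)` on a window
`0 < l₀` (a HYPOTHESIS), let `ν` be a continuum law of the string observable `∏os` (p505344 `exists_continuumLaw_of_target`: `∫ f(∏os) dgibbs_K → ∫ f dν`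
for every continuous `f`; `ν` lives on `[−1,1]`).  Then for every step `K`, every `Kg`-Lipschitz test function `g` with `|g| ≤ Gb` on `[−1,1]` and every
degree `n ≥ 1`:
`|∫ g(∏os) dgibbs_K − ∫ g dν| ≤ 2Kg∕√n + Gb·(3A_K)ⁿ·n!·2τ_K e^{2l₀}`, `τ_K = ∑_m 2vol·δ_{K+m}`, `A_K = max(1, e·max(1, log⁺τ_K⁻¹)∕l₀)`
— the law of `∏os` under `gibbs_K` and `ν` have cgf's `τ_K`-close on the window (`cgf = genFun_K`, `cgf_ν = genFunLim` by p505344, tail bound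
`T4CauchySum.abs_genFun_sub_lim_le`), and the sibling `…N19LawPriceSymmetric` prices laws on `[−1,1]`.  g9's continuum LAW made QUANTITATIVE. [bookkeeping] -/
theorem abs_integral_prodObs_sub_continuumLaw_le {vol l₀ : ℝ} {δ : ℕ → ℝ} (hl₀ : 0 < l₀) (os : List O)
    (hT : NE7.Target vol l₀ δ (schemeZ S os)) (ν : Measure ℝ) [IsProbabilityMeasure ν] (hν1 : ν (Icc (-1) 1)ᶜ = 0)
    (hν : ∀ f : ℝ → ℝ, Continuous f →
      Tendsto (fun K => ∫ U, f (prodObs S K os U) ∂gibbsMeasure (S.P K) (S.β K)) atTop (𝓝 (∫ x, f x ∂ν)))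
    {g : ℝ → ℝ} {Kg : NNReal} (hg : LipschitzWith Kg g) {Gb : ℝ} (hG : ∀ x ∈ Icc (-1 : ℝ) 1, |g x| ≤ Gb) (K : ℕ) {n : ℕ} (hn : 1 ≤ n) :
    |∫ U, g (prodObs S K os U) ∂gibbsMeasure (S.P K) (S.β K) - ∫ x, g x ∂ν| ≤
      2 * Kg / Real.sqrt n +
        Gb * (3 * max 1 (2 * Real.exp 1 * max 1 (Real.posLog (∑' m, 2 * (vol * δ (K + m)))⁻¹) / (2 * l₀))) ^ n *
          (n.factorial * (2 * (∑' m, 2 * (vol * δ (K + m))) * Real.exp (2 * l₀))) := by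
  obtain ⟨hM, hδ⟩ := hT
  haveI hP : IsProbabilityMeasure (gibbsMeasure (G := G) (S.P K) (S.β K)) :=
    T4GenFunBounds.isProbabilityMeasure_gibbsMeasure (G := G) (S.P K) (hβ K)
  set μK : Measure ℝ := (gibbsMeasure (S.P K) (S.β K)).map (prodObs S K os) with hμK
  haveI : IsProbabilityMeasure μK := Measure.isProbabilityMeasure_map (T4GenFunBounds.measurable_prodObs S hm K os).aemeasurable
  have hτ0 : 0 ≤ ∑' m, 2 * (vol * δ (K + m)) :=
    tsum_nonneg fun m => mul_nonneg two_pos.le (mul_nonneg_of_matchingModConstants hl₀.le hM (K + m))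
  -- cgf's of `μK` and `ν` are `τ_K`-close on the window
  have hclose : ∀ t : ℝ, |t| ≤ l₀ → |cgf id ν t - cgf id μK t| ≤ ∑' m, 2 * (vol * δ (K + m)) := fun t ht => by
    rw [hμK, cgf_map_prodObs S hβ hm h1 K os t, ← (genFunLim_eq_cgf_of_continuumLaw S hβ hm h1 os ν hν t).2, abs_sub_comm]
    exact abs_genFun_sub_lim_le hM hl₀.le hδ ht K
  have h := abs_integral_sub_integral_le_lipschitz_of_cgf_close_symm (μ := μK) (ν := ν) (map_prodObs_Icc_compl S hm h1 K os) hν1 hl₀ hτ0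
    hclose hg hG hn
  rw [hμK, integral_map (T4GenFunBounds.measurable_prodObs S hm K os).aemeasurable hg.continuous.aestronglyMeasurable, abs_sub_comm] at h
  exact h

/-- **★★ … HENCE BOUNDED-LIPSCHITZ CONVERGENCE, UNIFORMLY OVER THE TEST CLASS.**  Under `Target` on `0 < l₀`, with the continuum law `ν` of `∏os`:
for every `η > 0` there is a step `K₀` beyond which `|∫ g(∏os) dgibbs_K − ∫ g dν| ≤ η` for EVERY `1`-Lipschitz `g` with `|g| ≤ 1` on `[−1,1]` — the
sibling's uniform statement at the `ε₁(l₀, η)` of `law_controlled_of_cgf_close_symm`, and `τ_K → 0` (Mathlib `tendsto_sum_nat_add`).  Weak convergence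
(p505344 `tendsto_law_prodObs_of_continuumLaw`) upgraded to convergence in the bounded-Lipschitz metric, from N19's currency alone. [bookkeeping] -/
theorem boundedLipschitz_convergence_of_target {vol l₀ : ℝ} {δ : ℕ → ℝ} (hl₀ : 0 < l₀) (os : List O)
    (hT : NE7.Target vol l₀ δ (schemeZ S os)) (ν : Measure ℝ) [IsProbabilityMeasure ν] (hν1 : ν (Icc (-1) 1)ᶜ = 0)
    (hν : ∀ f : ℝ → ℝ, Continuous f →
      Tendsto (fun K => ∫ U, f (prodObs S K os U) ∂gibbsMeasure (S.P K) (S.β K)) atTop (𝓝 (∫ x, f x ∂ν)))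
    {η : ℝ} (hη : 0 < η) :
    ∃ K₀ : ℕ, ∀ K, K₀ ≤ K → ∀ g : ℝ → ℝ, LipschitzWith 1 g → (∀ x ∈ Icc (-1 : ℝ) 1, |g x| ≤ 1) →
      |∫ U, g (prodObs S K os U) ∂gibbsMeasure (S.P K) (S.β K) - ∫ x, g x ∂ν| ≤ η := by
  obtain ⟨hM, hδ⟩ := hT
  obtain ⟨ε₁, hε₁, hctl⟩ := law_controlled_of_cgf_close_symm hl₀ hη
  have hτ0 : ∀ K, 0 ≤ ∑' m, 2 * (vol * δ (K + m)) := fun K =>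
    tsum_nonneg fun m => mul_nonneg two_pos.le (mul_nonneg_of_matchingModConstants hl₀.le hM (K + m))
  have hτlim : Tendsto (fun K => ∑' m, 2 * (vol * δ (K + m))) atTop (𝓝 0) := by
    have h := tendsto_sum_nat_add fun j => 2 * (vol * δ j)
    exact h.congr fun i => tsum_congr fun k => by rw [add_comm]
  obtain ⟨K₀, hK₀⟩ := (hτlim.eventually (ge_mem_nhds hε₁)).exists_forall_of_atTop
  refine ⟨K₀, fun K hK g hg hG => ?_⟩
  haveI hP : IsProbabilityMeasure (gibbsMeasure (G := G) (S.P K) (S.β K)) :=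
    T4GenFunBounds.isProbabilityMeasure_gibbsMeasure (G := G) (S.P K) (hβ K)
  set μK : Measure ℝ := (gibbsMeasure (S.P K) (S.β K)).map (prodObs S K os) with hμK
  haveI : IsProbabilityMeasure μK := Measure.isProbabilityMeasure_map (T4GenFunBounds.measurable_prodObs S hm K os).aemeasurable
  have hclose : ∀ t : ℝ, |t| ≤ l₀ → |cgf id ν t - cgf id μK t| ≤ ∑' m, 2 * (vol * δ (K + m)) := fun t ht => by
    rw [hμK, cgf_map_prodObs S hβ hm h1 K os t, ← (genFunLim_eq_cgf_of_continuumLaw S hβ hm h1 os ν hν t).2, abs_sub_comm]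
    exact abs_genFun_sub_lim_le hM hl₀.le hδ ht K
  have h := hctl μK ν (map_prodObs_Icc_compl S hm h1 K os) hν1 _ (hτ0 K) (hK₀ K hK) hclose g hg hG
  rw [hμK, integral_map (T4GenFunBounds.measurable_prodObs S hm K os).aemeasurable hg.continuous.aestronglyMeasurable, abs_sub_comm] at h
  exact h

/-- **★ ASSEMBLED UNDER `Target` ALONE** (the continuum law supplied by p505344's `continuumLaw_of_target`): under `Spine.NE7.Target vol l₀ δ (schemeZ S os)`,
`0 < l₀`, there is a probability law `ν` on `[−1,1]` such that for every `η > 0`, beyond some step every `1`-Lipschitz `g` with `|g| ≤ 1` on `[−1,1]` has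
`|∫ g(∏os) dgibbs_K − ∫ g dν| ≤ η`. [bookkeeping] -/
theorem exists_continuumLaw_boundedLipschitz_of_target {vol l₀ : ℝ} {δ : ℕ → ℝ} (hl₀ : 0 < l₀) (os : List O)
    (hT : NE7.Target vol l₀ δ (schemeZ S os)) :
    ∃ ν : Measure ℝ, IsProbabilityMeasure ν ∧ ν (Icc (-1) 1)ᶜ = 0 ∧
      ∀ η : ℝ, 0 < η → ∃ K₀ : ℕ, ∀ K, K₀ ≤ K → ∀ g : ℝ → ℝ, LipschitzWith 1 g → (∀ x ∈ Icc (-1 : ℝ) 1, |g x| ≤ 1) →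
        |∫ U, g (prodObs S K os U) ∂gibbsMeasure (S.P K) (S.β K) - ∫ x, g x ∂ν| ≤ η := by
  obtain ⟨ν, iν, hν1, hν, -⟩ := continuumLaw_of_target S hβ hm h1 hl₀ os hT
  exact ⟨ν, iν, hν1, fun η hη => boundedLipschitz_convergence_of_target S hβ hm h1 hl₀ os hT ν hν1 hν hη⟩

end Scheme

end Summit.QuantumFields.YangMills.Theorems.BalabanUVNodesN19LawPriceAtScheme

end
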